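import Summits.BirchSwinnertonDyer.Rank1Residual.X2.NonsplitShaUnitMainConjecture
import Summits.BirchSwinnertonDyer.Rank1Residual.X2.CongruenceTransferMultiplicativeDerived
import Summits.BirchSwinnertonDyer.Rank1Residual.X2.CongruenceTransferCoveredNonsplit
import HarnessLib

/-!
# Route G at a NON-SPLIT Eisenstein `p` with a NON-SPLIT MULTIPLICATIVE relative closed by the `Ш`-unit road
# (`r'_an = 0`, `p ∤ #Ш'_an`, ANY `λ'`) — the heads (cell `bsd-eis`, seat `bsd-eis-k5-c3` gen 6; rung K5
# crux 3 `MazurMCOnCellB` = stmt-BirchSwinnertonDyer-19033; row A10 non-split; THEOREMS ONLY; file 3 of 3)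

HONEST FRAMING (FULL-BSD rank-≤1 programme D-0033, cell `bsd-eis`, home `run/shared/lean/pub/bsd-eis/`).
Nothing booked, no label moves; the class-wide crux is NOT claimed — per-pair CERTIFICATE road.
Theorems only (no definition, no named fact, nothing asserted).

THE POINT. Route G at a NON-SPLIT multiplicative Eisenstein prime `p` of a target `E₀` transfers
Mazur's main conjecture from a `p`-congruent relative `E₀'` (`E₀[p] ≅ E₀'[p]`). The tree's heads close
the relative either by Castella–Grossi–Skinner (GOOD relative, `hA`, T-EISRG3C), by the good `Ш`-unit
criterion (GOOD relative, `r' = 0`, `p ∤ #Ш'_an`, T-EISRG3XN), by a rank certificate (T-EISRG3RK), or —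
for a MULTIPLICATIVE relative — only by `λ`-minimality (`λ'_an ≤ rank`). File 2
(`X2/NonsplitShaUnitMainConjecture.lean`) closes a NON-SPLIT MULTIPLICATIVE relative with `r'_an = 0`
and `p ∤ #Ш'_an` for ANY analytic `λ'` (e.g. `λ'_an ≥ 2` coming from `p² ∣ ∏ c'_ℓ`): such relatives —
114 of them on 23 of the 44 non-split A10 cells in the cell's own Hesse-pencil search data
(HOME/k5-c3-g3, k5-c3-g4) — had NO road before. This file plugs that closure into gen 14's
multiplicative-relative heads (`X2.mazurMainConjectureAt_of_closedRelative_mult_of_facts`, shift DERIVED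
from Tate's uniformisation and Greenberg–Vatsal §1–§2): `hMC'` is DISCHARGED.

* `mazurMainConjectureAt_of_nonsplitShaUnitRelative_of_facts` — Mazur's MC at the non-split target
  (both ranks) from: target `μ_an = 0`, `λ_an = n`; relative NON-SPLIT multiplicative, `r'_an = 0`,
  `p ∤ #Ш'_an`, `μ'_an = 0`, `λ'_an = n'`; `TorsionIso`; `Σ₀`; `k = n' + Σ_{Σ₀}(δ' − δ)`, `n ≤ k`.
* `bsdp_of_nonsplitShaUnitRelative_rankZero_of_facts` — `BSD(E₀, p)` at `r_an(E₀) = 0`.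
* `missingInputB_of_nonsplitShaUnitRelative` — the Partition's bookkeeping form.

Binder delta versus the booked non-split tokens: T-EISRG3C = {hWu hW16 hpar hT hT′ hAm hBm hF hGV hA7 hB
hA …}; THIS road = {hW21 hWu h41 hGZK hpar hT hT′ hAm hBm hF} (MC head; `+ hJn hHn hmod` for `BSD(E₀,p)`)
— all REFEREED, no Castella–Grossi–Skinner / [BSTW] input, no rank certificate — with per pair
`hmult' hns'` (kernel), `hr' hunit' hμ0' hlam'` and `hμ0 hlam` (instrument), `hiso` + `Σ₀` table (kernel).

References: [GreenbergVatsal2000] Thm. (1.4), §1 (5)–(7), pp. 14–15, §2 pp. 20–27; [Wuthrich2014] Thm. 16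
(p. 397), Prop. 21 (p. 400); [GreenbergLNM1716] §4 pp. 112–113; [SteinWuthrich2013] Thm. 6.1;
[Silverman1994] Thm. V.5.3 / Cor. V.5.4 (Tate uniformisation, A40/A41).
-/

set_option autoImplicit false

noncomputable section

open scoped Classical MatrixGroups ModularForm NumberField

open PowerSeries CongruenceSubgroup WeierstrassCurve NumberField IsDedekindDomain Rat.HeightOneSpectrum
  Literature.NumberTheory.EllipticCurves
  Literature.NumberTheory.EllipticCurves.ModularForms
  Literature.NumberTheory.EllipticCurves.Rank1Residual
  Literature.NumberTheory.EllipticCurves.Rank1Residual.Typed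
  Literature.NumberTheory.EllipticCurves.Wuthrich2014
  Literature.NumberTheory.EllipticCurves.SteinWuthrich2013
  Literature.NumberTheory.EllipticCurves.Greenberg1999
  Literature.NumberTheory.EllipticCurves.GreenbergVatsal2000
  Summit.BirchSwinnertonDyer.BirchSwinnertonDyer.Theorems.Rank1ResidualX1Defs
  Summit.BirchSwinnertonDyer.Rank1Residual.X1.MuLambda
  Summit.BirchSwinnertonDyer.Rank1Residual.X1.MuPart
  Summit.BirchSwinnertonDyer.Rank1Residual.X1.ParitySqueeze
  Summit.BirchSwinnertonDyer.Rank1Residual.X1.TamagawaSqueeze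
  Summit.BirchSwinnertonDyer.Rank1Residual.X1.CongruenceTransfer
  Summit.BirchSwinnertonDyer.Rank1Residual.X2.CongruentLambdaShiftMultiplicative

namespace Summit.BirchSwinnertonDyer.Rank1Residual.X2

section NonsplitRelative

variable {W W' : WeierstrassCurve ℚ} [W.IsElliptic] [W.IsGloballyMinimal]
  [W'.IsElliptic] [W'.IsGloballyMinimal] {p : ℕ} [Fact p.Prime]
  (S₀ : Finset (HeightOneSpectrum (𝓞 ℚ)))

/-- **NON-SPLIT X2 pair, NON-SPLIT MULTIPLICATIVE closed relative (`r'_an = 0`, `p ∤ #Ш'_an`), shift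
DERIVED ⇒ Mazur's main conjecture at the pair** (both ranks of the target): `(E₀, p)` non-split
multiplicative, `E₀[p]` reducible, `p ≠ 2`, `μ_an(E₀) = 0`, `λ_an(E₀) = n`; `(E₀', p)` NON-SPLIT
multiplicative, `r_an(E₀') = 0`, `p ∤ #Ш(E₀')_an` (so `X2.MazurMainConjectureAt E₀' p` by §2 — for ANY
analytic `λ'`), `μ_an(E₀') = 0`, `λ_an(E₀') = n'`; `E₀[p] ≅ E₀'[p]` (`hiso`, whence `E₀'[p]` reducible);
`Σ₀ ∌ p` ⊇ bad places of both off `p`; `k = n' + Σ_{v∈Σ₀}(δ' − δ)` and the ONE integer inequality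
`n ≤ k` (then `=`). Gen 14's `mazurMainConjectureAt_of_closedRelative_mult_of_facts` with `hMC'`
DISCHARGED by `mazurMainConjectureAt_of_shaAn_unit_of_nonsplit_of_analyticRank_eq_zero`. Inputs beyond
certificates: Wuthrich 2014 Thm. 16 mult and Prop. 21, Greenberg §4 pp. 112–113, GZK, modularity, Tate's
uniformisation (A40/A41) and the Greenberg–Vatsal §1–§2 multiplicative statements — ALL REFEREED; NO
Castella–Grossi–Skinner input, no rank certificate. [cite: GreenbergVatsal2000, Thm. (1.4), §1 (5)–(7), pp. 14–15, §2 pp. 20–27]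
[cite: Wuthrich2014, Thm. 16 (p. 397) and Prop. 21 (p. 400)] [cite: GreenbergLNM1716, §4 pp. 112–113] -/
theorem mazurMainConjectureAt_of_nonsplitShaUnitRelative_of_facts (hW21 : sha_dvd_analyticSha)
    (hWu : thm16_charIdeal_dvd_multiplicative_of_reducible)
    (h41 : thm41Analogue_charValue_rankZero_numberField)
    (hGZK : rank_eq_analyticRank_of_analyticRank_le_one)
    (hpar : nonempty_modularParametrizationData)
    (hT : Silverman1994_thmV53_corV54_tateUniformisation.{0})
    (hT' : Silverman1994_thmV53_tateUniformisation.{0})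
    (hAm : lambda_nonPrimitive_eq_add_sum_delta_multiplicative)
    (hBm : datumSelmer_divisible_of_finite_torsionBy) (hF : datumStrictSelmer_lt_datumSelmer_of_split)
    (hp2 : p ≠ 2) (hmult : W.HasMultiplicativeReductionAtPrime p)
    (hns : ¬ W.HasSplitMultiplicativeReductionAtPrime p) (hred : ¬ W.HasIrreducibleModPGaloisRep p)
    {n : ℕ} (hμ0 : AnalyticMuLE W p 0) (hlam : AnalyticLambdaEq W p n)
    (hmult' : W'.HasMultiplicativeReductionAtPrime p)
    (hns' : ¬ W'.HasSplitMultiplicativeReductionAtPrime p) (hr' : W'.analyticRank = 0)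
    (hunit' : ∃ q : ℚ, shaAn W' = (q : ℂ) ∧ padicValRat p q = 0) {n' : ℕ}
    (hμ0' : AnalyticMuLE W' p 0) (hlam' : AnalyticLambdaEq W' p n')
    (hS₀ : ∀ v ∈ S₀, ((p : ℕ) : 𝓞 ℚ) ∉ v.asIdeal)
    (hS : ∀ v : HeightOneSpectrum (𝓞 ℚ), v ∉ S₀ → ((p : ℕ) : 𝓞 ℚ) ∉ v.asIdeal →
      W.HasGoodReductionAt v)
    (hS' : ∀ v : HeightOneSpectrum (𝓞 ℚ), v ∉ S₀ → ((p : ℕ) : 𝓞 ℚ) ∉ v.asIdeal →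
      W'.HasGoodReductionAt v)
    (hiso : TorsionIso W W' p) {k : ℕ}
    (hk : (k : ℤ) = n' + ∑ v ∈ S₀, ((delta W' p v : ℤ) - (delta W p v : ℤ))) (hn : n ≤ k) :
    X2.MazurMainConjectureAt W p :=
  have hred' : ¬ W'.HasIrreducibleModPGaloisRep p := not_hasIrreducibleModPGaloisRep_of_torsionIso hiso hred
  mazurMainConjectureAt_of_closedRelative_mult_of_facts S₀ hWu hpar hT hT' hAm hBm hF hp2 hmult hred hμ0
    hlam hmult'
    (mazurMainConjectureAt_of_shaAn_unit_of_nonsplit_of_analyticRank_eq_zero W' p hW21 hWu h41 hGZK hpar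
      hp2 hmult' hns' hred' hr' hunit')
    hμ0' hlam' (fun _ ↦ rfl) (fun h ↦ absurd h hns') hS₀ hS hS' hiso
    (by rw [if_neg hns', if_neg hns, add_zero, sub_zero]; exact hk)
    (fun _ ↦ hn) (fun h ↦ absurd h hns)

/-- **NON-SPLIT X2b pair (rank `0`), NON-SPLIT MULTIPLICATIVE `Ш`-unit relative, shift DERIVED ⇒
`BSD(E₀, p)`** — the rank-`0` headline; last step = the non-split forward glue
`bsdp_of_mazurMainConjectureAt_of_nonsplit_of_analyticRank_eq_zero` (Stein–Wuthrich Thm. 6.1 non-split,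
THE non-split height, GZK, modularity). [cite: GreenbergVatsal2000, Thm. (1.4), §2 pp. 20–27]
[cite: Wuthrich2014, Thm. 16 (p. 397) and Prop. 21 (p. 400)] [cite: GreenbergLNM1716, §4 pp. 112–113]
[cite: SteinWuthrich2013, Thm. 6.1 (p. 20)] -/
theorem bsdp_of_nonsplitShaUnitRelative_rankZero_of_facts (hW21 : sha_dvd_analyticSha)
    (hWu : thm16_charIdeal_dvd_multiplicative_of_reducible)
    (h41 : thm41Analogue_charValue_rankZero_numberField)
    (hJn : thm61_nonsplitMultiplicative) (hHn : exists_isMultCanonical)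
    (hGZK : rank_eq_analyticRank_of_analyticRank_le_one) (hmod : hasEntireLFunction_rat)
    (hpar : nonempty_modularParametrizationData)
    (hT : Silverman1994_thmV53_corV54_tateUniformisation.{0})
    (hT' : Silverman1994_thmV53_tateUniformisation.{0})
    (hAm : lambda_nonPrimitive_eq_add_sum_delta_multiplicative)
    (hBm : datumSelmer_divisible_of_finite_torsionBy) (hF : datumStrictSelmer_lt_datumSelmer_of_split)
    (W W' : WeierstrassCurve ℚ) [W.IsElliptic] [W.IsGloballyMinimal] [W'.IsElliptic]
    [W'.IsGloballyMinimal] (p : ℕ) [Fact p.Prime]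
    (hp2 : p ≠ 2) (hmult : W.HasMultiplicativeReductionAtPrime p)
    (hns : ¬ W.HasSplitMultiplicativeReductionAtPrime p) (hred : ¬ W.HasIrreducibleModPGaloisRep p)
    (hr : W.analyticRank = 0) {n : ℕ} (hμ0 : AnalyticMuLE W p 0) (hlam : AnalyticLambdaEq W p n)
    (hmult' : W'.HasMultiplicativeReductionAtPrime p)
    (hns' : ¬ W'.HasSplitMultiplicativeReductionAtPrime p) (hr' : W'.analyticRank = 0)
    (hunit' : ∃ q : ℚ, shaAn W' = (q : ℂ) ∧ padicValRat p q = 0) {n' : ℕ}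
    (hμ0' : AnalyticMuLE W' p 0) (hlam' : AnalyticLambdaEq W' p n')
    (hS₀ : ∀ v ∈ S₀, ((p : ℕ) : 𝓞 ℚ) ∉ v.asIdeal)
    (hS : ∀ v : HeightOneSpectrum (𝓞 ℚ), v ∉ S₀ → ((p : ℕ) : 𝓞 ℚ) ∉ v.asIdeal →
      W.HasGoodReductionAt v)
    (hS' : ∀ v : HeightOneSpectrum (𝓞 ℚ), v ∉ S₀ → ((p : ℕ) : 𝓞 ℚ) ∉ v.asIdeal →
      W'.HasGoodReductionAt v)
    (hiso : TorsionIso W W' p) {k : ℕ}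
    (hk : (k : ℤ) = n' + ∑ v ∈ S₀, ((delta W' p v : ℤ) - (delta W p v : ℤ))) (hn : n ≤ k) :
    BSDp W p :=
  bsdp_of_mazurMainConjectureAt_of_nonsplit_of_analyticRank_eq_zero W p hJn hHn hGZK hmod hpar hp2 hmult
    hns hr (mazurMainConjectureAt_of_nonsplitShaUnitRelative_of_facts S₀ hW21 hWu h41 hGZK hpar hT hT' hAm
      hBm hF hp2 hmult hns hred hμ0 hlam hmult' hns' hr' hunit' hμ0' hlam' hS₀ hS hS' hiso hk hn)

/-- **NON-SPLIT X2b pair: its TYPED INPUT `MissingInputB W p` from a NON-SPLIT MULTIPLICATIVE `Ш`-unit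
relative** (shift derived) — bookkeeping form for the Partition (`MissingInputB = X2.MazurMainConjectureAt`).
[cite: GreenbergVatsal2000, Thm. (1.4), §2 pp. 26–27] [cite: Wuthrich2014, Thm. 16 (p. 397) and Prop. 21 (p. 400)]
[cite: GreenbergLNM1716, §4 pp. 112–113] -/
theorem missingInputB_of_nonsplitShaUnitRelative (hW21 : sha_dvd_analyticSha)
    (hWu : thm16_charIdeal_dvd_multiplicative_of_reducible)
    (h41 : thm41Analogue_charValue_rankZero_numberField)
    (hGZK : rank_eq_analyticRank_of_analyticRank_le_one)
    (hpar : nonempty_modularParametrizationData)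
    (hT : Silverman1994_thmV53_corV54_tateUniformisation.{0})
    (hT' : Silverman1994_thmV53_tateUniformisation.{0})
    (hAm : lambda_nonPrimitive_eq_add_sum_delta_multiplicative)
    (hBm : datumSelmer_divisible_of_finite_torsionBy) (hF : datumStrictSelmer_lt_datumSelmer_of_split)
    (W W' : WeierstrassCurve ℚ) [W.IsElliptic] [W.IsGloballyMinimal] [W'.IsElliptic]
    [W'.IsGloballyMinimal] (p : ℕ) [Fact p.Prime] (hc : CellB W p)
    (hns : ¬ W.HasSplitMultiplicativeReductionAtPrime p) {n : ℕ}
    (hμ0 : AnalyticMuLE W p 0) (hlam : AnalyticLambdaEq W p n)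
    (hmult' : W'.HasMultiplicativeReductionAtPrime p)
    (hns' : ¬ W'.HasSplitMultiplicativeReductionAtPrime p) (hr' : W'.analyticRank = 0)
    (hunit' : ∃ q : ℚ, shaAn W' = (q : ℂ) ∧ padicValRat p q = 0) {n' : ℕ}
    (hμ0' : AnalyticMuLE W' p 0) (hlam' : AnalyticLambdaEq W' p n')
    (hS₀ : ∀ v ∈ S₀, ((p : ℕ) : 𝓞 ℚ) ∉ v.asIdeal)
    (hS : ∀ v : HeightOneSpectrum (𝓞 ℚ), v ∉ S₀ → ((p : ℕ) : 𝓞 ℚ) ∉ v.asIdeal →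
      W.HasGoodReductionAt v)
    (hS' : ∀ v : HeightOneSpectrum (𝓞 ℚ), v ∉ S₀ → ((p : ℕ) : 𝓞 ℚ) ∉ v.asIdeal →
      W'.HasGoodReductionAt v)
    (hiso : TorsionIso W W' p) {k : ℕ}
    (hk : (k : ℤ) = n' + ∑ v ∈ S₀, ((delta W' p v : ℤ) - (delta W p v : ℤ))) (hn : n ≤ k) :
    MissingInputB W p :=
  mazurMainConjectureAt_of_nonsplitShaUnitRelative_of_facts S₀ hW21 hWu h41 hGZK hpar hT hT' hAm hBm hF
    hc.2.1.1 hc.2.1.2.2 hns hc.2.1.2.1 hμ0 hlam hmult' hns' hr' hunit' hμ0' hlam' hS₀ hS hS' hiso hk hn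

end NonsplitRelative

end Summit.BirchSwinnertonDyer.Rank1Residual.X2

end
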